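import Summits.HubbardSuperconductivity.HubbardSuperconductivity.Theorems.NodalDiracTwistNodalDiracWeakCouplingOfUniqParity

/-!
# Crux `NodalDiracWeakCoupling` (stmt-HubbardSuperconductivity-10370) — `Lines/birth.lean`, skeleton v10

Route `NodalDiracTwist` (sub-problem `HubbardSuperconductivity`), crux rank 2:
`NodalDiracWeakCoupling` = `∀ U₀ > 0 ∃ U ∈ (0, U₀) ∃ δ ∈ [1/10, 3/10]`, NodalDirac(U, δ): at a node
momentum `κ` (`cos κ ≠ 0`), for every `ε > 0` and all large even non-resonant `L`, the
`(N_L, S^z = 0)`-sector ground state of the boost-gauge spin-twisted torus `H_L(U, φ)` (the route's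
inlined `let H` = `spinTwistedHubbardTorus L U φ` by `rfl`) is degenerate EXACTLY at the four
diagonal twists `(±c, ±c)` of the cell, `|cos c − cos Lκ| ≤ ε` (LOCUS), and the cyclic overlap
product of unit ground states around each of them, on every circle of radius
`r < min (c, π − c)` and every fine mesh, has NEGATIVE real part (SIGN).

## History: v1–v7 ("the sign is forced by the cone")

v1 (planner) … v7 (lead c9): the SIGN clause was derived from an exactly two-fold CONICAL crossing
(Herzberg–Longuet-Higgins forward theorem): stubs `stub_coneFrame` p142337, `stub_ellipseSqrt`
p141946, `stub_moebiusModel` p142578, `stub_moebiusAbstract` p142628, `stub_coneEnergy` p145692,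
`stub_annulusInvariance` p142752, `stub_rotCovariance` p149744, `stub_reflCovariance` p149562,
`cone_transport` p150518, glue `nodalDiracWeakCoupling_of_conicalQuartet` p145829 and
`nodalDiracWeakCoupling_of_conicalCore` p151068 — all landed; v7 = one `sorry`, the physics stub
`stub_conicalCore` (LOCUS on the triangle `0 ≤ φ₁ ≤ φ₀ ≤ π` + exactly-two-fold + CONE at `(c,c)`),
which leads c7–c15 handed back (`promote-stub`, nine times): it is the crux's own physics.

## v8 (lead c16, 2026-08-17): "the sign is forced by the PARITY FLIP" — a weaker physics stub

Longuet-Higgins read backwards through the `x₀ ↔ x₁` mirror of the square torus. On the diagonal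
`φ = (t,t)` the swap `U_{sr 3} = fockD4 (sr 3)` commutes with `H_L(U, φ)`, so a unique sector
ground state there has a swap parity `±1`, locally constant along diagonal segments of uniqueness
(landed, Bridge c12: `swapSign_const_on_diagonal_segment`). Around the diagonal point `(c, c)`
take the `8m`-gon whose lower half is the mirror image of its upper half: its cyclic overlap
product is `d₋ d̄₊ |P|²` (landed: `prod_overlap_reflectedLoop`), `d±` the parities at the two
diagonal vertices. Hence OPPOSITE parities on the two sides of `(c,c)` force a NEGATIVE product —
no cone, no two-foldness, no gap estimate. The new physics stub is therefore

* `stub_locusParity` (physics; OPEN): LOCUS on the triangle (as in v7) + NC1: the (unique) sector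
  ground states of `H_L(U,(0,0))` (periodic Hubbard torus) and `H_L(U,(π,π))` (gauge-equivalent
  to the doubly ANTIPERIODIC Hubbard torus) have opposite `x₀ ↔ x₁` parity;

strictly weaker than `stub_conicalCore` modulo landed mathematics (crux ⇒ NC1 is the landed
`stub_swapParityZeroVsPi`, crux ⇒ LOCUS is a restriction), so that v8 makes the crux EQUIVALENT
to LOCUS ∧ NC1. The three mathematics stubs (all provable now, M each):

* `stub_signOfParityFlip` — opposite parities at the diagonal vertices of a circle of uniqueness
  ⇒ the cyclic products of ALL unit ground-state choices on the `8m`-gons, `m ≥ m₀`, are negative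
  (reflected polygon + uniform overlap for `P ≠ 0` + cyclic phase cancellation);
* `stub_meshCoarsening` — on a circle of uniqueness the sign of the fine `n`-gon products equals
  that of the `kn`-gon products (`T`-real sections, real links, fan of thin triangles);
* `stub_rotLoopTransport` — the 90° rotation `U_{r 1}` (`stub_rotCovariance`) carries negativity
  of the `n`-gon products about `p` to the `n`-gon about `(−p₁, p₀)` when `4 ∣ n`.

Composition (no `sorry` of its own): LOCUS(triangle) ⇒ LOCUS(cell) (`deg_abs_iff`, `deg_swap_iff`);
uniqueness on every circle `|φ − p| = r < min(c, π−c)` about a locus point; NC1 + segment constancy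
⇒ opposite parities at the vertices `(c,c) + r(cos 5π/4, sin 5π/4)`, `(c,c) + r(cos π/4, sin π/4)`;
`stub_signOfParityFlip` ⇒ `8m`-gons; `stub_meshCoarsening` ⇒ all `n ≥ n₀` at `(c,c)`;
`stub_rotLoopTransport`³ + `stub_meshCoarsening` (`k = 4`) ⇒ the other three points; pack.
Barriers: `WeakCouplingCeiling` applies to `stub_locusParity` exactly as to the crux (not evaded).

## v9 (lead c16, 2026-08-17T14:05Z): the three mathematics stubs are LANDED — one sorry again

Wave 1 (three stub-workers, one message): `stub_rotLoopTransport` p163640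
(`Theorems/NodalDiracTwistNodalDiracWeakCouplingRotLoopTransport.lean`), `stub_meshCoarsening` p163941
(`…MeshCoarsening.lean`), `stub_signOfParityFlip` p164558 (`…SignOfParityFlip.lean`), all ACCEPTED
(axioms ⊆ {propext, Classical.choice, Quot.sound}); imported here, their `sorry`s removed. This
skeleton = the physics stub `stub_locusParity` + the sorry-free composition; `lean check`: rc 0,
errors [], sorries 1. The composition landed as `Theorems/…OfLocusParity.lean` (p165106:
`nodalDiracWeakCoupling_of_locusParity`, `sign_from_parity`) and the EQUIVALENCE
`nodalDiracWeakCoupling_iff_locusParity` (crux ⟺ LOCUS-triangle ∧ NC1) as `…IffLocusParity.lean`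
(p165286; converse via the Bridge lemma `swapSign_pi_opposite_swapSign_zero`).

## v10 (lead c16, 2026-08-17T14:40Z): the degeneracy AT `(c,c)` is forced too — physics = UNIQ ∧ NC1

If the ground state were unique also at `(c,c)` it would be unique on the whole diagonal `[0,π]`,
where the swap sign is then constant — contradicting NC1 (`degenerate_of_uniq_of_parity`,
`Theorems/…OfUniqParity.lean`). So LOCUS on the triangle splits into UNIQ (uniqueness at every
twist of the closed triangle other than `(c,c)`) plus a consequence of NC1, and the crux is
EQUIVALENT to UNIQ ∧ NC1 (`nodalDiracWeakCoupling_iff_uniqParity`, landed). This skeleton: the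
physics stub `stub_uniqParity` (= UNIQ ∧ NC1 with the crux's prefix) + a one-line composition
through the landed `nodalDiracWeakCoupling_of_uniqParity`. Since the stub is equivalent to the
crux by landed theorems, no further reshape inside ANY line can shrink it: what is left is the
crux's physics in minimal form (self-generated d_{x²−y²} ground state of the weakly repulsive 2D
Hubbard torus; `WeakCouplingCeiling` applies verbatim).
-/


-- the mandated namespace repeats `HubbardSuperconductivity` (single-problem summit, D-0017)
set_option linter.dupNamespace false

noncomputable section

namespace Summit.HubbardSuperconductivity.HubbardSuperconductivity.Cruxes.NodalDiracWeakCoupling.Birth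

open Literature.MathematicalPhysics.QuantumLattice Literature.Probability.LatticeModels Matrix
open Summit.HubbardSuperconductivity.HubbardSuperconductivity.Theses.NodalDiracTwist
open Summit.HubbardSuperconductivity.HubbardSuperconductivity.Theorems.NodalDiracTwist
open Summit.HubbardSuperconductivity.HubbardSuperconductivity.Theorems.NodalDiracTwist.BridgeNodalToDWave
open scoped BigOperators ComplexOrder Matrix

/-! ### The registered stub (physics) -/

/-- **STUB — `stub_uniqParity` (the physics; OPEN, XL; EQUIVALENT to the crux by the landed
`nodalDiracWeakCoupling_iff_uniqParity`).** `∀ U₀ > 0 ∃ U ∈ (0, U₀) ∃ δ ∈ [1/10, 3/10] ∃ κ`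
(`0 < κ < π`, `cos κ ≠ 0`) such that for every `ε > 0` and all large even non-resonant `L` there is
`c ∈ (0, π)` with `|cos c − cos (Lκ)| ≤ ε` and, for `N = 2⌊(1−δ)L²/2⌋`, `H(φ) = spinTwistedHubbardTorus L U φ`:
(UNIQ) at every twist `φ` of the closed triangle `0 ≤ φ₁ ≤ φ₀ ≤ π` other than `(c, c)` any two
`(N, S^z = 0)`-sector ground states of `H(φ)` are parallel;
(NC1) there are sector ground states `χ₀` of `H(0,0)` (the periodic Hubbard torus) and `χπ` of
`H(π,π)` (spin-gauge equivalent to the doubly antiperiodic Hubbard torus) which are eigenvectors of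
the swap `U_{sr 3}` (`(x₀,x₁) ↦ (x₁,x₀)`) with OPPOSITE signs `±1`.
BdG picture: UNIQ = one Nambu block closes at a time (non-resonance) and nowhere off the node;
NC1 = the number of occupied swap-fixed pair channels `(2πj/L)(1,1)` is odd (`2⌊Lκ/2π⌋+1`) on the
periodic grid and even on the half-shifted one. Why it might fail: verbatim as for the crux
(`WeakCouplingCeiling`, `L₀ ~ e^{C/U²}`; one stray crossing anywhere in the triangle kills UNIQ).
Sources: RaghuKivelsonScalapino2010 §III; Hatsugai2006; Scalapino1995 §2. -/
theorem stub_uniqParity :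
    ∀ U₀ : ℝ, 0 < U₀ → ∃ U ∈ Set.Ioo (0 : ℝ) U₀, ∃ δ ∈ Set.Icc (1 / 10 : ℝ) (3 / 10),
      ∃ κ : ℝ, 0 < κ ∧ κ < Real.pi ∧ Real.cos κ ≠ 0 ∧ ∀ ε : ℝ, 0 < ε → ∃ L₀ : ℕ,
        ∀ (L : ℕ) [NeZero L], Even L → L₀ ≤ L → (∀ m : ℤ, ε ≤ |L * κ - m * Real.pi|) →
          ∃ c : ℝ, 0 < c ∧ c < Real.pi ∧ |Real.cos c - Real.cos (L * κ)| ≤ ε ∧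
            (∀ φ : Fin 2 → ℝ, 0 ≤ φ 1 → φ 1 ≤ φ 0 → φ 0 ≤ Real.pi → ¬ (φ 0 = c ∧ φ 1 = c) →
              ∀ χ₁ χ₂ : Fock (Orb (FermionTorus 2 L)),
                IsGroundStateInSector (spinTwistedHubbardTorus L U φ) (2 * ⌊(1 - δ) * (L : ℝ) ^ 2 / 2⌋₊) 0 χ₁ →
                IsGroundStateInSector (spinTwistedHubbardTorus L U φ) (2 * ⌊(1 - δ) * (L : ℝ) ^ 2 / 2⌋₊) 0 χ₂ →
                ∃ z : ℂ, χ₂ = z • χ₁) ∧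
            (∃ χ₀ χπ : Fock (Orb (FermionTorus 2 L)),
                IsGroundStateInSector (spinTwistedHubbardTorus L U (fun _ : Fin 2 => (0 : ℝ))) (2 * ⌊(1 - δ) * (L : ℝ) ^ 2 / 2⌋₊) 0 χ₀ ∧
                IsGroundStateInSector (spinTwistedHubbardTorus L U (fun _ : Fin 2 => Real.pi)) (2 * ⌊(1 - δ) * (L : ℝ) ^ 2 / 2⌋₊) 0 χπ ∧
                (((@fockD4 L _ (DihedralGroup.sr 3)).val *ᵥ χ₀ = χ₀ ∧
                    (@fockD4 L _ (DihedralGroup.sr 3)).val *ᵥ χπ = -χπ) ∨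
                  ((@fockD4 L _ (DihedralGroup.sr 3)).val *ᵥ χ₀ = -χ₀ ∧
                    (@fockD4 L _ (DihedralGroup.sr 3)).val *ᵥ χπ = χπ))) := by
  sorry

/-! ### Composition (no `sorry` below this line) -/

/-- **COMPOSITION — the skeleton theorem: the crux `NodalDiracWeakCoupling` BY NAME from the single
physics stub `stub_uniqParity`**, through the landed `nodalDiracWeakCoupling_of_uniqParity`
(`Theorems/NodalDiracTwistNodalDiracWeakCouplingOfUniqParity.lean`: parity flip ⇒ degeneracy at
`(c,c)` ⇒ LOCUS on the triangle; `…OfLocusParity.lean`: `D₄` ⇒ LOCUS on the cell, segments + NC1 ⇒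
opposite parities at the diagonal vertices ⇒ sign of the `8m`-gons ⇒ all meshes ⇒ all four points).
No `sorry` of its own. -/
theorem NodalDiracWeakCoupling_of : NodalDiracWeakCoupling :=
  nodalDiracWeakCoupling_of_uniqParity stub_uniqParity

end Summit.HubbardSuperconductivity.HubbardSuperconductivity.Cruxes.NodalDiracWeakCoupling.Birth

end
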